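import Summits.QuantumFields.BalabanUV.T4Continuum.Support.NE3CurvedCornerGaugeSpace
import Summits.QuantumFields.BalabanUV.T4Continuum.Support.NE3TangentCovariantTower
import HarnessLib

/-!
# T⁴ programme, node NE3 — row E-MLw-(w4)-P, sub-row Φ6 at a CURVED background, file 2: THE CHART'S L1 AT `W` —
# `ker d(avg^k)_W ∩ {skew, periodic} = D_W Ξ₀ ⊕ T_pt(W)` (the corner-trivial gauge representative with vanishing COVARIANT
# divergence off the block corners, and the trivial intersection)

NE3 (node U1b) formalisation swarm `b2b-balaban-t4-ne3-formalise-*`, leaf seat `b2b-balaban-t4-ne3-formalise-leaf-01` (gen 5);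
INTENT journal ≈16:41Z; sequel of `NE3CurvedCornerGaugeSpace` (the projection step at `W`).  The flat case `W = 1` is this seat's
`NE3ProjectedLandauRepr` (p225823; `gaugeDir 1 μ = −dPot μ`).  Tangency through the tower is leaf-04's
`NE3TangentCovariantTower.tangentIter_add_gaugeDir_iff` BY NAME (the multi-level small-field class); the covariant summation by parts
is leaf-04's `NE3LandauOrbit.sum_hsR_gaugeDir`.

CONTENT ([folklore]; 0 sorry; 0 def):
§1 `tower_eq_pow_mul : tower L M j = L^j · M`;
§2 **`exists_cornerGauge_curvedProjLandau`** — `L ≥ 1`, `M ≠ 0`, `W` unitary, `tower L M (j+1)`-periodic, in the multi-level small-field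
   class (`0 ≤ x`, `LevelSmall d L j x`, `SmallField W x`); every skew `tower`-periodic `Y` with `TangentIter L j W Y` has a 𝔲(n)-valued,
   periodic, CORNER-TRIVIAL (`μ ((L^{j+1})•w) = 0`) generator `μ` such that `Z = Y + gaugeDir W μ` is skew, periodic, TANGENT
   (`TangentIter L j W Z`), and **`covDiv W Z ((L^{j+1})•z + v) = 0` for every block `z` and `v ∈ [0,L^{j+1})^d ∖ {0}`** — the chart's
   L1 representative IN the projected-Landau slice `T_pt(W)` of ρ-g21-2 (V4);
§3 **`gaugeDir_eq_zero_of_curvedProjLandau`** — the TRIVIAL INTERSECTION `D_W Ξ₀ ∩ T_pt(W) = {0}`: a periodic corner-trivial `μ` whose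
   gauge direction has vanishing covariant divergence off the corners has `gaugeDir W μ = 0` (unitary periodic `W`; NO smallness).

HONEST FRAMING.  Linear algebra and lattice kinematics at ONE fixed background in the small-field class; nothing about Bałaban's
minimisers; (P♮), (ML_w) at W ≠ 1, T-E_w, (μK-FR), (ζ-def) and **NE3 are NOT proved**; spine PROVED 0∕9; finite T⁴ rung (B)+1 —
NOT infinite volume, NOT mass gap, NOT `BetaPertH`, NOT Clay.  PLACEMENT: `Summits/QuantumFields/BalabanUV/`.  HONEST DEPENDENCY
(cell page 1): continuum YM on T⁴ ⇐ BetaPertH ∧ nine spine estimates (0/9 proved); BetaPertH ⇐ (D1) ∧ (D4) ∧ CAP+tail; G-an2-4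
gates asym, D1 and NE2/3/4.
-/

set_option autoImplicit false

open scoped BigOperators Matrix.Norms.L2Operator
open Finset

namespace Summit.QuantumFields.BalabanUV.T4Continuum.NE3CurvedProjectedLandau

open Literature.MathematicalPhysics.QuantumFieldTheory.Balaban1983to89
open B7Prop1Explicit B7Prop2Explicit MatrixNorms
open T4AveragingDeficitWall (IsSkewDir IsUnitaryCfg SmallField Ad)
open T4AveragingDeficitWallBoundary (periodBox mem_periodBox IsPeriodicCfg)
open AveragingDeficitPeriodicCounting (IsPeriodicDir)
open AveragingDeficitMultiLevelPrep (TangentIter tower LevelSmall)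
open BlockAveragePushDirGauge (gaugeDir isPeriodicDir_gaugeDir)
open NE3CovariantCalculus (hsR hsR_self)
open NE3CovariantWeitzenbock (covDiv)
open NE3LandauOrbit (eq_zero_of_nhsNormSq_eq_zero sum_hsR_gaugeDir gaugeDir_skew hsR_zero_left hsR_zero_right)
open NE3BlockLineAverage (sum_periodBox_blocks)
open PeriodicChoice (apply_wrap_eq wrap_mem_periodBox)
open NE3TangentCovariantTower (tangentIter_add_gaugeDir_iff)
open NE3CurvedCornerGaugeSpace (cornerGaugeSpace₀ mem_cornerGaugeSpace₀_iff exists_orthogonalW covDiv_eq_zero_offCorner_of_orthogonal)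

noncomputable section

variable {d : ℕ} {n : Type*} [Fintype n] [DecidableEq n]

/-! ## §1 The tower period -/

omit [Fintype n] [DecidableEq n] in
/-- `tower L M j = L^j · M`. [folklore] -/
theorem tower_eq_pow_mul (L M : ℕ) : ∀ j : ℕ, tower L M j = L ^ j * M
  | 0 => by simp [tower]
  | j + 1 => by rw [tower, tower_eq_pow_mul L M j, pow_succ]; ring

/-! ## §2 Existence: the corner-trivial gauge representative in `T_pt(W)` -/

/-- **THE CHART'S L1 AT A CURVED BACKGROUND — EXISTENCE.**  `L ≥ 1`, `M ≠ 0`; `W` unitary and `tower L M (j+1)`-periodic in the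
multi-level small-field class; `Y` skew, `tower L M (j+1)`-periodic, `TangentIter L j W Y`.  Then there is a 𝔲(n)-valued,
`tower L M (j+1)`-periodic generator `μ` vanishing on the corner lattice `(L^{j+1})•ℤ^d` such that `Z = Y + gaugeDir W μ` is skew,
periodic, TANGENT, and has covariant divergence `covDiv W Z = 0` at every site off the corner lattice — `Z ∈ T_pt(W)`
(projection onto `(gaugeDir W Ξ₀)^⊥` by `exists_orthogonalW`; orthogonality ⇒ divergence clause by `covDiv_eq_zero_offCorner_of_orthogonal`;
tangency by leaf-04's `tangentIter_add_gaugeDir_iff`). [folklore] -/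
theorem exists_cornerGauge_curvedProjLandau [Nonempty n] {L M : ℕ} [NeZero M] (hL : 1 ≤ L) (j : ℕ)
    {W : Site d → Fin d → (Matrix n n ℂ)ˣ} {x : ℝ} (hWu : IsUnitaryCfg W)
    (hWP : IsPeriodicCfg W ((tower L M (j + 1) : ℕ) : ℤ)) (hx : 0 ≤ x) (hs : LevelSmall d L j x) (hWx : SmallField W x)
    {Y : Site d → Fin d → Matrix n n ℂ} (hYs : IsSkewDir Y) (hYP : IsPeriodicDir Y ((tower L M (j + 1) : ℕ) : ℤ))
    (hYT : TangentIter L j W Y) :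
    ∃ μ : Site d → Matrix n n ℂ, (∀ y, μ y ∈ skewAdjoint (Matrix n n ℂ))
      ∧ (∀ (y : Site d) (i : Fin d), μ (y + ((tower L M (j + 1) : ℕ) : ℤ) • e i) = μ y)
      ∧ (∀ w : Site d, μ (((L ^ (j + 1) : ℕ) : ℤ) • w) = 0)
      ∧ IsSkewDir (fun y ν => Y y ν + gaugeDir W μ y ν)
      ∧ IsPeriodicDir (fun y ν => Y y ν + gaugeDir W μ y ν) ((tower L M (j + 1) : ℕ) : ℤ)
      ∧ TangentIter L j W (fun y ν => Y y ν + gaugeDir W μ y ν)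
      ∧ ∀ (z v : Site d), v ∈ periodBox (d := d) (L ^ (j + 1)) → v ≠ 0 →
          covDiv W (fun y ν => Y y ν + gaugeDir W μ y ν) (((L ^ (j + 1) : ℕ) : ℤ) • z + v) = 0 := by
  set P : ℕ := tower L M (j + 1) with hPdef
  set Mb : ℕ := L ^ (j + 1) with hMbdef
  have hM1 : 1 ≤ M := Nat.one_le_iff_ne_zero.mpr (NeZero.ne M)
  have hMb : 1 ≤ Mb := Nat.one_le_pow _ _ hL
  have hPeq : P = Mb * M := by rw [hPdef, hMbdef]; exact tower_eq_pow_mul L M (j + 1)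
  have hP1 : 1 ≤ P := by rw [hPeq]; exact Nat.one_le_iff_ne_zero.mpr (Nat.mul_ne_zero (by omega) (by omega))
  have hcast : ((L : ℤ) ^ (j + 1)) = (Mb : ℤ) := by rw [hMbdef]; push_cast; ring
  -- the projection step
  obtain ⟨μ, hμmem, horth⟩ := exists_orthogonalW (d := d) (n := n) (P := P) (M := Mb) hP1 hMb hWP Y
  obtain ⟨hμP, hμ0, hμs⟩ := mem_cornerGaugeSpace₀_iff.mp hμmem
  set Z : Site d → Fin d → Matrix n n ℂ := fun y ν => Y y ν + gaugeDir W μ y ν with hZdef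
  have hgP : IsPeriodicDir (gaugeDir W μ) ((P : ℕ) : ℤ) := isPeriodicDir_gaugeDir hWP hμP
  have hZP : IsPeriodicDir Z ((P : ℕ) : ℤ) := fun y i ν => by simp only [hZdef, hYP y i ν, hgP y i ν]
  have hZs : IsSkewDir Z := fun y ν => (skewAdjoint _).add_mem (hYs y ν) (gaugeDir_skew hWu hμs y ν)
  have hμ0' : ∀ z : Site d, μ (((L : ℤ) ^ (j + 1)) • z) = 0 := fun z => by rw [hcast]; exact hμ0 z
  refine ⟨μ, hμs, hμP, hμ0, hZs, hZP, ?_, ?_⟩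
  · -- tangency survives corner-trivial gauge directions
    exact (tangentIter_add_gaugeDir_iff (M := M) hL j hWu hWP hx hs hWx Y hμs hμP hμ0').mpr hYT
  · -- the divergence clause from orthogonality
    have hWP' : IsPeriodicCfg W ((Mb * M : ℕ) : ℤ) := by rw [← hPeq]; exact hWP
    have hZP' : IsPeriodicDir Z ((Mb * M : ℕ) : ℤ) := by rw [← hPeq]; exact hZP
    have horth' : ∀ η : Site d → Matrix n n ℂ, (∀ (y : Site d) (κ : Fin d), η (y + ((Mb * M : ℕ) : ℤ) • e κ) = η y) →
        (∀ w : Site d, η ((Mb : ℤ) • w) = 0) → (∀ y : Site d, η y ∈ skewAdjoint (Matrix n n ℂ)) →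
        ∑ y ∈ periodBox (d := d) (Mb * M), ∑ ν : Fin d, hsR (Z y ν) (gaugeDir W η y ν) = 0 := by
      intro η hηP hη0 hηs
      have hηP' : ∀ (y : Site d) (κ : Fin d), η (y + (P : ℤ) • e κ) = η y := by rw [hPeq]; exact hηP
      have h := horth η (mem_cornerGaugeSpace₀_iff.mpr ⟨hηP', hη0, hηs⟩)
      rw [hPeq] at h
      exact h
    intro z v hv hv0
    have hvMb : v ∈ periodBox (d := d) Mb := by rw [hMbdef]; exact hv
    have h := covDiv_eq_zero_offCorner_of_orthogonal hMb hM1 hWu hWP' hZs hZP' horth' z v hvMb hv0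
    rw [hMbdef] at h
    exact h

/-! ## §3 The trivial intersection `D_W Ξ₀ ∩ T_pt(W) = {0}` -/

/-- **A CORNER-TRIVIAL GAUGE DIRECTION WITH VANISHING COVARIANT DIVERGENCE OFF THE CORNERS IS ZERO.**  `Mb, N ≥ 1`; `W` unitary and
`(Mb·N)`-periodic; `μ` `(Mb·N)`-periodic with `μ (Mb•w) = 0`; if `covDiv W (gaugeDir W μ) (Mb•z + v) = 0` for every block `z` and
`v ∈ [0,Mb)^d ∖ {0}`, then `gaugeDir W μ = 0` — by the covariant summation by parts `Σ‖D_Wμ‖²_HS = Σ_x ⟨covDiv_W(D_Wμ)(x), μ(x)⟩_HS`,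
whose right side vanishes block by block (corner: `μ = 0`; elsewhere: divergence `0`).  No smallness needed. [folklore] -/
theorem gaugeDir_eq_zero_of_curvedProjLandau {Mb N : ℕ} (hMb : 1 ≤ Mb) (hN : 1 ≤ N) {W : Site d → Fin d → (Matrix n n ℂ)ˣ}
    (hWu : IsUnitaryCfg W) (hWP : IsPeriodicCfg W ((Mb * N : ℕ) : ℤ)) {μ : Site d → Matrix n n ℂ}
    (hμP : ∀ (y : Site d) (i : Fin d), μ (y + ((Mb * N : ℕ) : ℤ) • e i) = μ y) (hμ0 : ∀ w : Site d, μ ((Mb : ℤ) • w) = 0)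
    (hdiv : ∀ (z v : Site d), v ∈ periodBox (d := d) Mb → v ≠ 0 →
      covDiv W (gaugeDir W μ) ((Mb : ℤ) • z + v) = 0) :
    gaugeDir W μ = 0 := by
  have hP : 1 ≤ Mb * N := Nat.one_le_iff_ne_zero.mpr (Nat.mul_ne_zero (by omega) (by omega))
  have hgP : IsPeriodicDir (gaugeDir W μ) ((Mb * N : ℕ) : ℤ) := isPeriodicDir_gaugeDir hWP hμP
  have h := sum_hsR_gaugeDir hP hWu hgP hμP
  -- the right side vanishes block by block
  have hblock : ∀ z : Site d,
      ∑ v ∈ periodBox (d := d) Mb, hsR (covDiv W (gaugeDir W μ) ((Mb : ℤ) • z + v)) (μ ((Mb : ℤ) • z + v)) = 0 := by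
    intro z
    refine Finset.sum_eq_zero fun v hv => ?_
    by_cases hv0 : v = 0
    · subst hv0; rw [add_zero, hμ0 z, hsR_zero_right]
    · rw [hdiv z v hv hv0, hsR_zero_left]
  have hR : ∑ y ∈ periodBox (d := d) (Mb * N), hsR (covDiv W (gaugeDir W μ) y) (μ y) = 0 := by
    rw [← sum_periodBox_blocks Mb N hMb (fun y => hsR (covDiv W (gaugeDir W μ) y) (μ y))]
    exact Finset.sum_eq_zero fun z _ => hblock z
  rw [hR] at h
  simp only [hsR_self] at h
  have hbox : ∀ y ∈ periodBox (d := d) (Mb * N), ∀ ν : Fin d, gaugeDir W μ y ν = 0 := by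
    intro y hy ν
    have h1 := (Finset.sum_eq_zero_iff_of_nonneg fun y' _ =>
      Finset.sum_nonneg fun ν' _ => nhsNormSq_nonneg (gaugeDir W μ y' ν')).1 h y hy
    have h2 := (Finset.sum_eq_zero_iff_of_nonneg fun ν' _ => nhsNormSq_nonneg (gaugeDir W μ y ν')).1 h1 ν (Finset.mem_univ ν)
    exact eq_zero_of_nhsNormSq_eq_zero h2
  funext y ν
  have hw := apply_wrap_eq (g := fun y' => gaugeDir W μ y' ν) (fun y' κ => hgP y' κ ν) y
  rw [Pi.zero_apply, Pi.zero_apply, ← hw]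
  exact hbox _ (wrap_mem_periodBox (Mb * N) hP y) ν

end

end Summit.QuantumFields.BalabanUV.T4Continuum.NE3CurvedProjectedLandau
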